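import Summits.ResolutionOfSingularities.ResolutionOfSingularities.Theorems.FrobeniusLadderFInjectiveMacaulayficationFCForallExistsCylinder
import Summits.ResolutionOfSingularities.ResolutionOfSingularities.Theorems.FrobeniusLadderFInjectiveMacaulayficationCylinderOfPointModelFin
import HarnessLib

/-!
# The FC′ `𝔸ᴺ`-CYLINDER INSTANCE: the body of `FCForallExists` for `X₁ = Y × 𝔸ᴺ` at the generic point of `{y₀} × 𝔸ᴺ` (scars of every
# dimension `N`), `Y = Spec R` with one isolated point-fixable bad closed point
# (crux `FInjectiveMacaulayfication` stmt-ResolutionOfSingularities-15315, chain w45a, hole #3γ; res-L1-w45a-plan-1 R13.9 (4) / R13.13 (3);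
# seat res-L1-w45a-stub-3)

[OURS · L1 W4.5a] Support file (`--supports stmt-ResolutionOfSingularities-15315 --as helper`); NOT a statement of any manuscript; no named
fact; AI-written (AI review is weaker than expert review). The `N`-variable twin of `…FCForallExistsCylinder.lean` (which is the case
`N = 1`): same hypotheses on `Y = Spec R` (`R` a Noetherian domain of characteristic `p`, `y₀` closed, `hoff` = every other local ring satisfies
the clause, `h0` = `y₀` point-fixable), `X₁ = Spec R[t₁,…,t_N]` (`(MvPolynomial (Fin N) R)`), `η = 𝔪_{y₀}·R[t]` = the generic point of the
`N`-dimensional scar `{y₀} × 𝔸ᴺ`; conclusion = the seven conjuncts of `GenericFibreReduction.FCForallExists` VERBATIM at `(X₁, η)`, with the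
bonus that every blowing up along the witness `J = ((c₀) ∩ R)·R[t]~` is FULL at every stalk. The only change in the proof is the cylinder
ascent: `CylinderOfPointModelFin.affineBlowup_fiClause_mvPolynomial` (S4 iterated) instead of `AffineBlowupPolynomial.affineBlowup_fiClause_polynomial`;
§0/§1 of the one-variable file (`stalkIdeal_idealSheaf`, `mem_support_idealSheaf_iff`, `affineBlowup_fiClause_of_pointFix`) are reused BY NAME.
So the v29 door stub `stub_fcForallExists` is inhabited at points `η` whose closure has ANY dimension (product scars).
No definitions, no named facts. [folklore assembly; cite: StacksProject, Tag 0804, Tag 0805, Tag 02OS]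
-/

-- single-problem summit: the doubled namespace component is forced
set_option linter.dupNamespace false

noncomputable section

open AlgebraicGeometry CategoryTheory Literature.AlgebraicGeometry.Resolution TopologicalSpace IsLocalRing

namespace Summit.ResolutionOfSingularities.ResolutionOfSingularities.Theorems.FInjectiveMacaulayfication.FCForallExistsCylinderFin

open Summit.ResolutionOfSingularities.ResolutionOfSingularities.Theorems.FInjectiveMacaulayfication

/-! ## §1 The cylinder `Spec R[t₁,…,t_N]`: every blowing up along `(I·R[t])~` is FULL at every stalk -/

/-- **§1 — THE CYLINDER `Bl × 𝔸ᴺ` OVER A GOOD POINT MODEL IS FULL, FOR EVERY BLOWING UP ALONG `(I·R[t₁,…,t_N])~`.** If every stalk of `Bl_I(Spec R)` is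
a domain satisfying the clause (`R` a Noetherian domain of characteristic `p`), then so is every stalk of every blowing up
`π : X₂ → Spec R[t₁,…,t_N]` along the ideal sheaf of `I·R[t]` (universal property): `Bl_{I R[t]} = Bl_I × 𝔸ᴺ` is FULL everywhere by the
iterated cylinder ascent (`CylinderOfPointModelFin.affineBlowup_fiClause_mvPolynomial`), it IS a blowing up along `(I·R[t])~`
(`affineBlowup.isBlowup`, GW Prop. 13.92), and two blowing ups along the same ideal sheaf have the same stalks (`IsBlowupStalkTransfer`).
[cite: GortzWedhorn2020, Prop. 13.92 and (13.19)] -/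
theorem fiClause_of_isBlowup_cylinderFin (p : ℕ) [Fact p.Prime] (R : Type) [CommRing R] [IsDomain R] [IsNoetherianRing R]
    [CharP R p] (N : ℕ) (I : Ideal R)
    (hBl : ∀ y : ↥(affineBlowup I), IsDomain ((affineBlowup I).presheaf.stalk y) ∧
      ∀ d : ℕ, ringKrullDim ((affineBlowup I).presheaf.stalk y) = d →
        ∀ s : Fin d → (affineBlowup I).presheaf.stalk y, (Ideal.span (Set.range s)).radical.IsMaximal →
          RingTheory.Sequence.IsWeaklyRegular ((affineBlowup I).presheaf.stalk y) (List.ofFn s) ∧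
          ∀ z : (affineBlowup I).presheaf.stalk y, (∃ e : ℕ, z ^ p ^ e ∈
              Ideal.span ((fun w : (affineBlowup I).presheaf.stalk y => w ^ p ^ e) ''
                (Ideal.span (Set.range s) : Set ((affineBlowup I).presheaf.stalk y)))) →
            z ∈ Ideal.span (Set.range s)) :
    ∀ (X₂ : Scheme.{0}) (π : X₂ ⟶ Spec (.of (MvPolynomial (Fin N) R))), IsBlowup π (affineBlowup.idealSheaf (I.map (MvPolynomial.C : R →+* (MvPolynomial (Fin N) R)))) →
      ∀ x : X₂, IsDomain (X₂.presheaf.stalk x) ∧ ∀ d : ℕ, ringKrullDim (X₂.presheaf.stalk x) = d → ∀ s : Fin d → X₂.presheaf.stalk x,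
        (Ideal.span (Set.range s)).radical.IsMaximal → RingTheory.Sequence.IsWeaklyRegular (X₂.presheaf.stalk x) (List.ofFn s) ∧
        ∀ t : X₂.presheaf.stalk x, (∃ e : ℕ, t ^ p ^ e ∈ Ideal.span ((fun z : X₂.presheaf.stalk x => z ^ p ^ e) ''
          (Ideal.span (Set.range s) : Set (X₂.presheaf.stalk x)))) → t ∈ Ideal.span (Set.range s) := by
  intro X₂ π hπ x
  obtain ⟨x'', -, ⟨e⟩⟩ := IsBlowupStalkTransfer.stub_isBlowupStalkTransfer _ _ _ _ π
    (affineBlowup.π (I.map (MvPolynomial.C : R →+* (MvPolynomial (Fin N) R)))) hπ (affineBlowup.isBlowup _) x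
  obtain ⟨hdom, hcl⟩ := CylinderOfPointModelFin.affineBlowup_fiClause_mvPolynomial p R I hBl N x''
  haveI := hdom
  exact ⟨MulEquiv.isDomain _ e.toMulEquiv,
    DegreeZeroDescent.inlineClause_of_ringEquiv p (L := (affineBlowup (I.map (MvPolynomial.C : R →+* (MvPolynomial (Fin N) R)))).presheaf.stalk x'')
      (L' := X₂.presheaf.stalk x) e.symm hcl⟩

/-! ## §2 The FC′ body for the cylinder at the generic point of `{y₀} × 𝔸ᴺ` -/

set_option maxHeartbeats 400000 in
/-- **§2 — THE `𝔸ᴺ`-CYLINDER WITNESS (strong form).** `R` a Noetherian domain of characteristic `p`, `y₀ ∈ Spec R` closed with all other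
local rings satisfying the clause (`hoff`) and `y₀` point-fixable (`h0`), `η = 𝔪_{y₀}·R[t₁,…,t_N]` (the generic point of `{y₀} × 𝔸ᴺ`). Then for
`J := (I·R[t])~`, `I = (c₀) ∩ R`, and `c' :=` the image of `c₀` in `𝒪_{X₁,η}`: `J ≠ ⊥`, `η ∈ supp J`, `(c') ≠ 0`, `(c') ≤ 𝔪_η`,
every chart of `Bl_{(c')} Spec 𝒪_η` over `𝔪_η` is FULL, `J_η = (c')`, and EVERY blowing up of `Spec R[t₁,…,t_N]` along `J` is FULL AT
EVERY STALK. [cite: StacksProject, Tag 0804, Tag 0805] -/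
theorem cylinderFin_witness (p : ℕ) [Fact p.Prime] (R : Type) [CommRing R] [IsDomain R] [IsNoetherianRing R] [CharP R p] (N : ℕ)
    (y₀ : Spec (.of R)) (hy₀ : IsClosed ({y₀} : Set (Spec (.of R))))
    (hoff : ∀ y : Spec (.of R), y ≠ y₀ → ∀ d : ℕ, ringKrullDim (Localization.AtPrime y.asIdeal) = d →
      ∀ s : Fin d → Localization.AtPrime y.asIdeal, (Ideal.span (Set.range s)).radical.IsMaximal →
        RingTheory.Sequence.IsWeaklyRegular (Localization.AtPrime y.asIdeal) (List.ofFn s) ∧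
        ∀ z : Localization.AtPrime y.asIdeal, (∃ e : ℕ, z ^ p ^ e ∈ Ideal.span ((fun w : Localization.AtPrime y.asIdeal => w ^ p ^ e) ''
          (Ideal.span (Set.range s) : Set (Localization.AtPrime y.asIdeal)))) → z ∈ Ideal.span (Set.range s))
    (h0 : ∃ (m : ℕ) (c₀ : Fin m → (Spec (.of R)).presheaf.stalk y₀), Ideal.span (Set.range c₀) ≠ ⊥ ∧
      (Ideal.span (Set.range c₀)).radical = maximalIdeal ((Spec (.of R)).presheaf.stalk y₀) ∧
      ∀ (j : Fin m) (𝔔 : PrimeSpectrum (blowupAlgebra (Ideal.span (Set.range c₀)) (c₀ j))),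
        𝔔.asIdeal.comap (algebraMap ((Spec (.of R)).presheaf.stalk y₀) (blowupAlgebra (Ideal.span (Set.range c₀)) (c₀ j))) =
          maximalIdeal ((Spec (.of R)).presheaf.stalk y₀) →
        IsDomain (Localization.AtPrime 𝔔.asIdeal) ∧ ∀ d : ℕ, ringKrullDim (Localization.AtPrime 𝔔.asIdeal) = d →
          ∀ s : Fin d → Localization.AtPrime 𝔔.asIdeal, (Ideal.span (Set.range s)).radical.IsMaximal →
            RingTheory.Sequence.IsWeaklyRegular (Localization.AtPrime 𝔔.asIdeal) (List.ofFn s) ∧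
            ∀ y : Localization.AtPrime 𝔔.asIdeal, (∃ e : ℕ, y ^ p ^ e ∈ Ideal.span ((fun z : Localization.AtPrime 𝔔.asIdeal => z ^ p ^ e) ''
              (Ideal.span (Set.range s) : Set (Localization.AtPrime 𝔔.asIdeal)))) → y ∈ Ideal.span (Set.range s))
    (η : Spec (.of (MvPolynomial (Fin N) R))) (hη : η.asIdeal = y₀.asIdeal.map (MvPolynomial.C : R →+* (MvPolynomial (Fin N) R))) :
    ∃ (J : (Spec (.of (MvPolynomial (Fin N) R))).IdealSheafData) (n' : ℕ) (c' : Fin n' → (Spec (.of (MvPolynomial (Fin N) R))).presheaf.stalk η),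
      J ≠ ⊥ ∧ η ∈ (J.support : Set (Spec (.of (MvPolynomial (Fin N) R)))) ∧
      Ideal.span (Set.range c') ≠ ⊥ ∧ Ideal.span (Set.range c') ≤ maximalIdeal ((Spec (.of (MvPolynomial (Fin N) R))).presheaf.stalk η) ∧
      (∀ (j : Fin n') (𝔔 : PrimeSpectrum (blowupAlgebra (Ideal.span (Set.range c')) (c' j))),
        𝔔.asIdeal.comap (algebraMap ((Spec (.of (MvPolynomial (Fin N) R))).presheaf.stalk η) (blowupAlgebra (Ideal.span (Set.range c')) (c' j))) =
          maximalIdeal ((Spec (.of (MvPolynomial (Fin N) R))).presheaf.stalk η) →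
        IsDomain (Localization.AtPrime 𝔔.asIdeal) ∧ ∀ d : ℕ, ringKrullDim (Localization.AtPrime 𝔔.asIdeal) = d →
          ∀ s : Fin d → Localization.AtPrime 𝔔.asIdeal, (Ideal.span (Set.range s)).radical.IsMaximal →
            RingTheory.Sequence.IsWeaklyRegular (Localization.AtPrime 𝔔.asIdeal) (List.ofFn s) ∧
            ∀ y : Localization.AtPrime 𝔔.asIdeal, (∃ e : ℕ, y ^ p ^ e ∈ Ideal.span ((fun z : Localization.AtPrime 𝔔.asIdeal => z ^ p ^ e) ''
              (Ideal.span (Set.range s) : Set (Localization.AtPrime 𝔔.asIdeal)))) → y ∈ Ideal.span (Set.range s)) ∧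
      stalkIdeal J η = Ideal.span (Set.range c') ∧
      ∀ (X₂ : Scheme.{0}) (π : X₂ ⟶ Spec (.of (MvPolynomial (Fin N) R))), IsBlowup π J →
        ∀ x : X₂, IsDomain (X₂.presheaf.stalk x) ∧ ∀ d : ℕ, ringKrullDim (X₂.presheaf.stalk x) = d → ∀ s : Fin d → X₂.presheaf.stalk x,
          (Ideal.span (Set.range s)).radical.IsMaximal → RingTheory.Sequence.IsWeaklyRegular (X₂.presheaf.stalk x) (List.ofFn s) ∧
          ∀ t : X₂.presheaf.stalk x, (∃ e : ℕ, t ^ p ^ e ∈ Ideal.span ((fun z : X₂.presheaf.stalk x => z ^ p ^ e) ''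
            (Ideal.span (Set.range s) : Set (X₂.presheaf.stalk x)))) → t ∈ Ideal.span (Set.range s) := by
  obtain ⟨m, c₀, hc0, hrad, hgood⟩ := h0
  -- the structure-sheaf algebras on the two stalks: `𝒪_{y₀} = R_{𝔪₀}`, `𝒪_η = R[t]_η`
  letI algY : Algebra R ((Spec (.of R)).presheaf.stalk y₀) :=
    inferInstanceAs (Algebra R ((Spec.structureSheaf R).presheaf.stalk y₀))
  haveI : IsLocalization.AtPrime ((Spec (.of R)).presheaf.stalk y₀) y₀.asIdeal :=
    inferInstanceAs (IsLocalization.AtPrime ((Spec.structureSheaf R).presheaf.stalk y₀) y₀.asIdeal)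
  letI algX : Algebra (MvPolynomial (Fin N) R) ((Spec (.of (MvPolynomial (Fin N) R))).presheaf.stalk η) :=
    inferInstanceAs (Algebra (MvPolynomial (Fin N) R) ((Spec.structureSheaf (MvPolynomial (Fin N) R)).presheaf.stalk η))
  haveI : IsLocalization.AtPrime ((Spec (.of (MvPolynomial (Fin N) R))).presheaf.stalk η) η.asIdeal :=
    inferInstanceAs (IsLocalization.AtPrime ((Spec.structureSheaf (MvPolynomial (Fin N) R)).presheaf.stalk η) η.asIdeal)
  -- the contracted centre `I = (c₀) ∩ R`: `I·𝒪_{y₀} = (c₀)`, `I ≠ 0`, `√I = 𝔪_{y₀}`, `V(I) = {y₀}`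
  set I : Ideal R := (Ideal.span (Set.range c₀)).under R with hIdef
  have hImap : I.map (algebraMap R ((Spec (.of R)).presheaf.stalk y₀)) = Ideal.span (Set.range c₀) :=
    IsLocalization.map_under y₀.asIdeal.primeCompl ((Spec (.of R)).presheaf.stalk y₀) _
  have hI0 : I ≠ ⊥ := fun h => hc0 (by rw [← hImap, h, Ideal.map_bot])
  have hm : y₀.asIdeal.IsMaximal := (PrimeSpectrum.isClosed_singleton_iff_isMaximal y₀).mp hy₀
  have hIrad : I.radical = y₀.asIdeal := by
    rw [hIdef, Ideal.under_def, ← Ideal.comap_radical, hrad]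
    exact IsLocalization.AtPrime.under_maximalIdeal ((Spec (.of R)).presheaf.stalk y₀) y₀.asIdeal
  have hIle : I ≤ y₀.asIdeal := hIrad ▸ Ideal.le_radical
  have hIy : ∀ y : Spec (.of R), y ∈ ((affineBlowup.idealSheaf I).support : Set (Spec (.of R))) → y = y₀ := by
    intro y hy
    rw [FCForallExistsCylinder.mem_support_idealSheaf_iff] at hy
    have h1 : y₀.asIdeal ≤ y.asIdeal := hIrad ▸ (y.isPrime.radical_le_iff.mpr hy)
    exact (PrimeSpectrum.ext (hm.eq_of_le y.isPrime.ne_top h1)).symm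
  have hIc : stalkIdeal (affineBlowup.idealSheaf I) y₀ = Ideal.span (Set.range c₀) := (FCForallExistsCylinder.stalkIdeal_idealSheaf I y₀).trans hImap
  -- §1 + §2: every blowing up of `Spec R[t]` along `J = (I·R[t])~` is FULL at every stalk
  have hBl := FCForallExistsCylinder.affineBlowup_fiClause_of_pointFix p R y₀ hoff c₀ hrad hgood I hIc hIy
  have hfull := fiClause_of_isBlowup_cylinderFin p R N I hBl
  -- §3 the witness at `η`: `ψ : 𝒪_{y₀} → 𝒪_η` over `C : R → R[t]`, `c' = ψ ∘ c₀`
  have hMT : y₀.asIdeal.primeCompl ≤ η.asIdeal.primeCompl.comap (MvPolynomial.C : R →+* (MvPolynomial (Fin N) R)) := by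
    intro s hs
    change MvPolynomial.C s ∉ η.asIdeal
    rw [hη]
    intro h
    exact hs (by simpa using (MvPolynomial.mem_map_C_iff.mp h) 0)
  let ψ : (Spec (.of R)).presheaf.stalk y₀ →+* (Spec (.of (MvPolynomial (Fin N) R))).presheaf.stalk η :=
    IsLocalization.map (M := y₀.asIdeal.primeCompl) (T := η.asIdeal.primeCompl) ((Spec (.of (MvPolynomial (Fin N) R))).presheaf.stalk η)
      (MvPolynomial.C : R →+* (MvPolynomial (Fin N) R)) hMT
  have hψ : ψ.comp (algebraMap R ((Spec (.of R)).presheaf.stalk y₀)) = (algebraMap (MvPolynomial (Fin N) R) ((Spec (.of (MvPolynomial (Fin N) R))).presheaf.stalk η)).comp MvPolynomial.C :=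
    IsLocalization.map_comp hMT
  let c' : Fin m → (Spec (.of (MvPolynomial (Fin N) R))).presheaf.stalk η := fun j => ψ (c₀ j)
  have hspan : Ideal.span (Set.range c') = (Ideal.span (Set.range c₀)).map ψ := by
    rw [Ideal.map_span, ← Set.range_comp]
    rfl
  -- `J_η = I·𝒪_η = (c')`
  have h1 : stalkIdeal (affineBlowup.idealSheaf (I.map (MvPolynomial.C : R →+* (MvPolynomial (Fin N) R)))) η =
      (I.map (MvPolynomial.C : R →+* (MvPolynomial (Fin N) R))).map (algebraMap (MvPolynomial (Fin N) R) ((Spec (.of (MvPolynomial (Fin N) R))).presheaf.stalk η)) :=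
    FCForallExistsCylinder.stalkIdeal_idealSheaf _ _
  have hJη : stalkIdeal (affineBlowup.idealSheaf (I.map (MvPolynomial.C : R →+* (MvPolynomial (Fin N) R)))) η = Ideal.span (Set.range c') := by
    rw [h1, Ideal.map_map, ← hψ, ← Ideal.map_map, hImap, hspan]
  -- `(c') ≤ 𝔪_η`
  have hle : Ideal.span (Set.range c') ≤ maximalIdeal ((Spec (.of (MvPolynomial (Fin N) R))).presheaf.stalk η) := by
    rw [hspan]
    calc (Ideal.span (Set.range c₀)).map ψ ≤ (maximalIdeal ((Spec (.of R)).presheaf.stalk y₀)).map ψ :=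
          Ideal.map_mono (Ideal.le_radical.trans hrad.le)
      _ = maximalIdeal ((Spec (.of (MvPolynomial (Fin N) R))).presheaf.stalk η) := by
          rw [← IsLocalization.AtPrime.map_eq_maximalIdeal y₀.asIdeal ((Spec (.of R)).presheaf.stalk y₀), Ideal.map_map, hψ,
            ← Ideal.map_map, ← hη, IsLocalization.AtPrime.map_eq_maximalIdeal η.asIdeal ((Spec (.of (MvPolynomial (Fin N) R))).presheaf.stalk η)]
  -- `(c') ≠ 0`
  have hne : Ideal.span (Set.range c') ≠ ⊥ := by
    rw [← hJη, h1]
    have hinj : Function.Injective (algebraMap (MvPolynomial (Fin N) R) ((Spec (.of (MvPolynomial (Fin N) R))).presheaf.stalk η)) :=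
      IsLocalization.injective _ η.asIdeal.primeCompl_le_nonZeroDivisors
    intro h
    exact hI0 ((Ideal.map_eq_bot_iff_of_injective (MvPolynomial.C_injective (Fin N) R)).mp ((Ideal.map_eq_bot_iff_of_injective hinj).mp h))
  -- `η ∈ supp J`, `J ≠ ⊥`
  have hηJ : η ∈ ((affineBlowup.idealSheaf (I.map (MvPolynomial.C : R →+* (MvPolynomial (Fin N) R)))).support : Set (Spec (.of (MvPolynomial (Fin N) R)))) := by
    rw [FCForallExistsCylinder.mem_support_idealSheaf_iff, hη]
    exact Ideal.map_mono hIle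
  have hJ0 : affineBlowup.idealSheaf (I.map (MvPolynomial.C : R →+* (MvPolynomial (Fin N) R))) ≠ ⊥ :=
    affineBlowup.idealSheaf_ne_bot fun h => hI0 ((Ideal.map_eq_bot_iff_of_injective (MvPolynomial.C_injective (Fin N) R)).mp h)
  -- the charts of `Bl_{(c')} Spec 𝒪_η` over `𝔪_η` are stalks of `Bl_{I R[t]}` (reverse dictionary), hence FULL
  have hgood' : ∀ (j : Fin m) (𝔔 : PrimeSpectrum (blowupAlgebra (Ideal.span (Set.range c')) (c' j))),
      𝔔.asIdeal.comap (algebraMap ((Spec (.of (MvPolynomial (Fin N) R))).presheaf.stalk η) (blowupAlgebra (Ideal.span (Set.range c')) (c' j))) =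
        maximalIdeal ((Spec (.of (MvPolynomial (Fin N) R))).presheaf.stalk η) →
      IsDomain (Localization.AtPrime 𝔔.asIdeal) ∧ ∀ d : ℕ, ringKrullDim (Localization.AtPrime 𝔔.asIdeal) = d →
        ∀ s : Fin d → Localization.AtPrime 𝔔.asIdeal, (Ideal.span (Set.range s)).radical.IsMaximal →
          RingTheory.Sequence.IsWeaklyRegular (Localization.AtPrime 𝔔.asIdeal) (List.ofFn s) ∧
          ∀ y : Localization.AtPrime 𝔔.asIdeal, (∃ e : ℕ, y ^ p ^ e ∈ Ideal.span ((fun z : Localization.AtPrime 𝔔.asIdeal => z ^ p ^ e) ''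
            (Ideal.span (Set.range s) : Set (Localization.AtPrime 𝔔.asIdeal)))) → y ∈ Ideal.span (Set.range s) := by
    intro j 𝔔 h𝔔
    obtain ⟨x', -, ⟨e⟩⟩ :=
      (affineBlowup.isBlowup (I.map (MvPolynomial.C : R →+* (MvPolynomial (Fin N) R)))).exists_point_of_blowupAlgebra_prime η c' hJη.symm j 𝔔 h𝔔
    obtain ⟨hdom, hcl⟩ := hfull _ _ (affineBlowup.isBlowup _) x'
    haveI := hdom
    exact ⟨MulEquiv.isDomain _ e.symm.toMulEquiv,
      DegreeZeroDescent.inlineClause_of_ringEquiv p (L := (affineBlowup (I.map (MvPolynomial.C : R →+* (MvPolynomial (Fin N) R)))).presheaf.stalk x')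
        (L' := Localization.AtPrime 𝔔.asIdeal) e hcl⟩
  exact ⟨affineBlowup.idealSheaf (I.map (MvPolynomial.C : R →+* (MvPolynomial (Fin N) R))), m, c', hJ0, hηJ, hne, hle, hgood', hJη, hfull⟩

/-- **THE FC′ `𝔸ᴺ`-CYLINDER INSTANCE — the body of `GenericFibreReduction.FCForallExists` (currency (A′), §G5b) PRODUCED for
`X₁ = Spec R × 𝔸ᴺ` at the generic point `η` of `{y₀} × 𝔸ᴺ` (a scar of dimension `N`, any `N`)**, from `hoff` (all local rings of `Spec R` other than `y₀` satisfy the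
clause) and `h0` (point-fixability of `y₀`, the 5e output): an ideal sheaf `J ≠ ⊥` with `η ∈ supp J`, a LocFix datum `c'` at `η`
(`(c') ≠ 0`, `(c') ≤ 𝔪_η`, charts FULL over `𝔪_η`) with `J_η = (c')`, such that every blowing up along `J` is FULL at the non-closed
points over `supp J ∖ {η}` and Cohen–Macaulay at the closed points over `supp J` — literally the seven conjuncts of the v29 door stub's
conclusion. (`cylinderFin_witness` gives more: every stalk of every such blowing up is FULL.) Inhabited instances of the research stub
`stub_fcForallExists` with scars of every dimension; calibration rungs, not evidence for FC′ at non-product scars. [folklore assembly; cite: StacksProject, Tag 0805] -/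
theorem fcForallExists_body_cylinderFin (p : ℕ) [Fact p.Prime] (R : Type) [CommRing R] [IsDomain R] [IsNoetherianRing R] [CharP R p] (N : ℕ)
    (y₀ : Spec (.of R)) (hy₀ : IsClosed ({y₀} : Set (Spec (.of R))))
    (hoff : ∀ y : Spec (.of R), y ≠ y₀ → ∀ d : ℕ, ringKrullDim (Localization.AtPrime y.asIdeal) = d →
      ∀ s : Fin d → Localization.AtPrime y.asIdeal, (Ideal.span (Set.range s)).radical.IsMaximal →
        RingTheory.Sequence.IsWeaklyRegular (Localization.AtPrime y.asIdeal) (List.ofFn s) ∧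
        ∀ z : Localization.AtPrime y.asIdeal, (∃ e : ℕ, z ^ p ^ e ∈ Ideal.span ((fun w : Localization.AtPrime y.asIdeal => w ^ p ^ e) ''
          (Ideal.span (Set.range s) : Set (Localization.AtPrime y.asIdeal)))) → z ∈ Ideal.span (Set.range s))
    (h0 : ∃ (m : ℕ) (c₀ : Fin m → (Spec (.of R)).presheaf.stalk y₀), Ideal.span (Set.range c₀) ≠ ⊥ ∧
      (Ideal.span (Set.range c₀)).radical = maximalIdeal ((Spec (.of R)).presheaf.stalk y₀) ∧
      ∀ (j : Fin m) (𝔔 : PrimeSpectrum (blowupAlgebra (Ideal.span (Set.range c₀)) (c₀ j))),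
        𝔔.asIdeal.comap (algebraMap ((Spec (.of R)).presheaf.stalk y₀) (blowupAlgebra (Ideal.span (Set.range c₀)) (c₀ j))) =
          maximalIdeal ((Spec (.of R)).presheaf.stalk y₀) →
        IsDomain (Localization.AtPrime 𝔔.asIdeal) ∧ ∀ d : ℕ, ringKrullDim (Localization.AtPrime 𝔔.asIdeal) = d →
          ∀ s : Fin d → Localization.AtPrime 𝔔.asIdeal, (Ideal.span (Set.range s)).radical.IsMaximal →
            RingTheory.Sequence.IsWeaklyRegular (Localization.AtPrime 𝔔.asIdeal) (List.ofFn s) ∧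
            ∀ y : Localization.AtPrime 𝔔.asIdeal, (∃ e : ℕ, y ^ p ^ e ∈ Ideal.span ((fun z : Localization.AtPrime 𝔔.asIdeal => z ^ p ^ e) ''
              (Ideal.span (Set.range s) : Set (Localization.AtPrime 𝔔.asIdeal)))) → y ∈ Ideal.span (Set.range s))
    (η : Spec (.of (MvPolynomial (Fin N) R))) (hη : η.asIdeal = y₀.asIdeal.map (MvPolynomial.C : R →+* (MvPolynomial (Fin N) R))) :
    ∃ (J : (Spec (.of (MvPolynomial (Fin N) R))).IdealSheafData) (n' : ℕ) (c' : Fin n' → (Spec (.of (MvPolynomial (Fin N) R))).presheaf.stalk η),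
      J ≠ ⊥ ∧ η ∈ (J.support : Set (Spec (.of (MvPolynomial (Fin N) R)))) ∧
      Ideal.span (Set.range c') ≠ ⊥ ∧ Ideal.span (Set.range c') ≤ maximalIdeal ((Spec (.of (MvPolynomial (Fin N) R))).presheaf.stalk η) ∧
      (∀ (j : Fin n') (𝔔 : PrimeSpectrum (blowupAlgebra (Ideal.span (Set.range c')) (c' j))),
        𝔔.asIdeal.comap (algebraMap ((Spec (.of (MvPolynomial (Fin N) R))).presheaf.stalk η) (blowupAlgebra (Ideal.span (Set.range c')) (c' j))) =
          maximalIdeal ((Spec (.of (MvPolynomial (Fin N) R))).presheaf.stalk η) →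
        IsDomain (Localization.AtPrime 𝔔.asIdeal) ∧ ∀ d : ℕ, ringKrullDim (Localization.AtPrime 𝔔.asIdeal) = d →
          ∀ s : Fin d → Localization.AtPrime 𝔔.asIdeal, (Ideal.span (Set.range s)).radical.IsMaximal →
            RingTheory.Sequence.IsWeaklyRegular (Localization.AtPrime 𝔔.asIdeal) (List.ofFn s) ∧
            ∀ y : Localization.AtPrime 𝔔.asIdeal, (∃ e : ℕ, y ^ p ^ e ∈ Ideal.span ((fun z : Localization.AtPrime 𝔔.asIdeal => z ^ p ^ e) ''
              (Ideal.span (Set.range s) : Set (Localization.AtPrime 𝔔.asIdeal)))) → y ∈ Ideal.span (Set.range s)) ∧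
      stalkIdeal J η = Ideal.span (Set.range c') ∧
      (∀ (X₂ : Scheme.{0}) (π : X₂ ⟶ Spec (.of (MvPolynomial (Fin N) R))), IsBlowup π J →
        (∀ x : X₂, π.base x ∈ (J.support : Set (Spec (.of (MvPolynomial (Fin N) R)))) → π.base x ≠ η → ¬ IsClosed ({x} : Set X₂) →
          IsDomain (X₂.presheaf.stalk x) ∧ ∀ d : ℕ, ringKrullDim (X₂.presheaf.stalk x) = d → ∀ s : Fin d → X₂.presheaf.stalk x,
            (Ideal.span (Set.range s)).radical.IsMaximal → RingTheory.Sequence.IsWeaklyRegular (X₂.presheaf.stalk x) (List.ofFn s) ∧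
            ∀ t : X₂.presheaf.stalk x, (∃ e : ℕ, t ^ p ^ e ∈ Ideal.span ((fun z : X₂.presheaf.stalk x => z ^ p ^ e) ''
              (Ideal.span (Set.range s) : Set (X₂.presheaf.stalk x)))) → t ∈ Ideal.span (Set.range s)) ∧
        (∀ x : X₂, π.base x ∈ (J.support : Set (Spec (.of (MvPolynomial (Fin N) R)))) → IsClosed ({x} : Set X₂) →
          ∀ d : ℕ, ringKrullDim (X₂.presheaf.stalk x) = d → ∀ s : Fin d → X₂.presheaf.stalk x,
            (Ideal.span (Set.range s)).radical.IsMaximal → RingTheory.Sequence.IsWeaklyRegular (X₂.presheaf.stalk x) (List.ofFn s))) := by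
  obtain ⟨J, n', c', hJ0, hηJ, hne, hle, hgood', hJη, hfull⟩ := cylinderFin_witness p R N y₀ hy₀ hoff h0 η hη
  exact ⟨J, n', c', hJ0, hηJ, hne, hle, hgood', hJη, fun X₂ π hπ =>
    ⟨fun x _ _ _ => hfull X₂ π hπ x, fun x _ _ d hd s hs => ((hfull X₂ π hπ x).2 d hd s hs).1⟩⟩

end Summit.ResolutionOfSingularities.ResolutionOfSingularities.Theorems.FInjectiveMacaulayfication.FCForallExistsCylinderFin

end
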